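import Summits.QuantumFields.YangMills.Theorems.IR.PurityChannelSeams
import Summits.QuantumFields.YangMills.Theorems.BalabanLadderIRColdDoublingRecursionSC
import HarnessLib

/-!
# Crux `IR` (stmt-QuantumFields-19354) — SEAM of line `jensen-purity-channel`, PROVED:
# `SparseChannel ∧ ComplexAnchor (∧ PoissonJensen) ⇒ E`

Helper module for item `stmt-QuantumFields-19354` (`--supports … --as helper`; it closes nothing).  Companion of
`Theorems/IR/PurityChannelSeams.lean` (tools + the seam of LINE 1 `harmonic-purity-channel`).  Over the verbatim vocabulary
`Theorems/IR/PurityChannelDefs.lean` it proves the `M/L` seam stub `stub_exit_of_sparse` left sorried by the ideator (ym-ir-idea-16 g0)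
in the UNREGISTERED skeleton `Cruxes/IR/Lines/jensen_purity_channel.lean` — so that, with the classical leg P landed in
`Theorems/IR/PurityChannelClassical.lean` (p635605), LINE 2 is now `SparseChannel ∧ ComplexAnchor ⇒ E` with everything else kernel-checked.

* `coldExitSC_of_sparse_poissonJensen : SparseChannel → ComplexAnchor → PoissonJensen → ColdExitSC` — VERBATIM the body of
  `stub_exit_of_sparse` (closes it by `exact`; checked on the farm against a verbatim copy of the workfile's statements): per `(G, r)`,
  `ε := ε₀`, `β ≥ β₁`; `F = Z_t² − Z_{2t}` (holomorphic on `U` by holomorphy in the weight), `G = g² ∏_{ζ∈s+s}(· − ζ) = Z_t²` on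
  `closure D`; on `frontier D`: `‖F‖ ≤ (1+M)‖G‖`; on the anchor circle: `‖F‖ = ‖Z_t‖²‖1 − h_L‖ ≤ a_L‖G‖`, `a_L = (|C|+1)L⁴e^{−cL}`;
  the zeros `s` miss the closed anchor disc because `Z_t ≠ 0` there (anchor) and miss `z_T` by hypothesis; Poisson–Jensen gives
  `coldDefect · Z_t(β)² = Re F(z_T) ≤ ‖F(z_T)‖ ≤ a_L^ω A^{1−ω} e^{2·greenBudget} Z_t(β)²` with `greenBudget ≤ θ_L L`; the sublinear
  loss is absorbed by half the anchor rate once `θ_L ≤ ωc/4` (`rpow_mul_exp_le_of_sublinear`: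
  `a_L^ω e^{2θ_L L} ≤ ((|C|+1)L⁴e^{−cL/2})^ω`), and `ω` is `L`-independent, so purity `≤ ε` at all large `L`.
  Plus the P-free form `coldExitSC_of_sparse : SparseChannel → ComplexAnchor → ColdExitSC` over `poissonJensen_holds`.
* §2 (appended) the two lines' BILLS by name: `IR_of_purityChannel : PurityChannel → ComplexAnchor → AFToColdPressure → IRnsc →
  BalabanLadder.IR` and `IR_of_sparseChannel : SparseChannel → ComplexAnchor → AFToColdPressure → IRnsc → BalabanLadder.IR`
  (seam + the PROVED `AspectBootstrap.R_holds` + the PROVED `ColdPurityBridge.IR_of_bridge`).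

HONEST FRAMING.  A seam of a CONDITIONAL ideator line whose load `SparseChannel` is the infrared wall typed lower than LINE 1's but
not removed (in every standard scenario Fisher-zero families are extensive) and whose supplier `ComplexAnchor` is OPEN; nothing here
bears on confinement, a lattice gap, `BalabanLadder.IR` (0/1) or the Yang–Mills mass gap (Clay), which are NOT proved; `R4` closes
only the conditional finite-𝕋⁴ rung `BalabanLadder.UV`.
-/

set_option autoImplicit false

noncomputable section

open Filter Topology MeasureTheory
open Literature.MathematicalPhysics.QuantumFieldTheory Literature.MathematicalPhysics.QuantumLattice
open Summit.QuantumFields.YangMills.Cruxes.IR.ColdPurityBridge (coldDefect ColdExitSC)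

namespace Summit.QuantumFields.YangMills.Cruxes.IR.PurityChannelFamily

/-- **P is a tree theorem** (`PurityChannelClassical.poissonJensen_holds`, p635605; the body there is `PoissonJensen` unfolded). -/
theorem poissonJensen_holds : PoissonJensen :=
  PurityChannelClassical.poissonJensen_holds

/-! ## §1 The SEAM of line jensen-purity-channel: `SparseChannel ∧ ComplexAnchor ∧ PoissonJensen ⇒ E` -/

/-- Doubling a zero multiset squares the Blaschke-type polynomial. -/
theorem zeroProd_add (s t : Multiset ℂ) (z : ℂ) : zeroProd (s + t) z = zeroProd s z * zeroProd t z := by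
  simp [zeroProd, Multiset.map_add, Multiset.prod_add]

/-- Doubling a zero multiset doubles the Green budget. -/
theorem greenBudget_add (s t : Multiset ℂ) (zT : ℂ) (R : ℝ) :
    greenBudget (s + t) zT R = greenBudget s zT R + greenBudget t zT R := by
  simp [greenBudget, Multiset.map_add, Multiset.sum_add]

/-- The Blaschke-type polynomial vanishes at each of its zeros. -/
theorem zeroProd_eq_zero_of_mem {s : Multiset ℂ} {ζ : ℂ} (h : ζ ∈ s) : zeroProd s ζ = 0 :=
  Multiset.prod_eq_zero (Multiset.mem_map.2 ⟨ζ, h, sub_self ζ⟩)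

/-- The anchor rate absorbs a sublinear exponential loss: if `θ ≤ ω c / 4` then
`(K L⁴ e^{−cL})^ω · e^{2 θ L} ≤ (K L⁴ e^{−(c/2) L})^ω` (`K ≥ 0`). -/
theorem rpow_mul_exp_le_of_sublinear {K c ω θ : ℝ} (hK : 0 ≤ K) (L : ℕ) (hθ : θ ≤ ω * c / 4) :
    (K * (L : ℝ) ^ 4 * Real.exp (-(c * (L : ℝ)))) ^ ω * Real.exp (2 * θ * (L : ℝ)) ≤
      (K * (L : ℝ) ^ 4 * Real.exp (-(c / 2 * (L : ℝ)))) ^ ω := by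
  have hP : 0 ≤ K * (L : ℝ) ^ 4 := by positivity
  have hexp : Real.exp (-(c * (L : ℝ))) = Real.exp (-(c / 2 * (L : ℝ))) * Real.exp (-(c / 2 * (L : ℝ))) := by
    rw [← Real.exp_add]
    congr 1
    ring
  have hsplit : K * (L : ℝ) ^ 4 * Real.exp (-(c * (L : ℝ))) =
      (K * (L : ℝ) ^ 4 * Real.exp (-(c / 2 * (L : ℝ)))) * Real.exp (-(c / 2 * (L : ℝ))) := by
    rw [hexp]
    ring
  rw [hsplit, Real.mul_rpow (by positivity) (Real.exp_pos _).le, ← Real.exp_mul, mul_assoc, ← Real.exp_add]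
  refine mul_le_of_le_one_right (by positivity) ?_
  rw [Real.exp_le_one_iff]
  have hL : (0 : ℝ) ≤ L := Nat.cast_nonneg L
  nlinarith

/-- **SEAM (body of `stub_exit_of_sparse`, line jensen-purity-channel): `SparseChannel → ComplexAnchor → PoissonJensen →
ColdExitSC`.**  Per `(G, r)`: `ε := ε₀` of the anchor; for `β ≥ β₁` the channel data; `F := Z_t² − Z_{2t}` (holomorphic on `U` by
holomorphy in the weight), `G := g² · ∏_{ζ∈s+s}(· − ζ) = Z_t²` on `closure D`; on `frontier D`: `‖F‖ ≤ (1 + M)‖G‖`; on the anchor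
circle: `‖F‖ = ‖Z_t‖²‖1 − h_L‖ ≤ a_L ‖G‖`, `a_L = (|C|+1)L⁴e^{−cL}`; the zeros `s` miss the closed anchor disc because `Z_t ≠ 0` there
(anchor); Poisson–Jensen ⇒ `coldDefect · Z_t(β)² = Re F(zT) ≤ a_L^ω A^{1−ω} e^{2θ_L L} Z_t(β)²`, and `a_L^ω e^{2θ_L L} ≤
((|C|+1)L⁴e^{−cL/2})^ω → 0` once `θ_L ≤ ωc/4` (`θ_L → 0`, `ω` independent of `L`). -/
theorem coldExitSC_of_sparse_poissonJensen (hJ : SparseChannel) (hA : ComplexAnchor) (hP : PoissonJensen) :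
    ColdExitSC := by
  intro G _ _ _ _ hG hsc
  letI : MeasurableSpace G := borel G
  haveI : BorelSpace G := ⟨rfl⟩
  intro r ε hε
  haveI : SecondCountableTopology G := r.secondCountableTopology
  obtain ⟨ε₀, C, c, hε₀, hc, L₀A, hAnch⟩ := hA
  obtain ⟨β₁, hβ₁⟩ := hJ G hG hsc r ε₀ hε₀
  refine ⟨β₁, fun β hβ L₁ => ?_⟩
  obtain ⟨U, D, w, z₀, zT, δ₀, R, M, B, θ, L₀Z, hUo, hDo, hDb, hDc, hDU, hδ₀, hdisc, hΩc, hzT, hzTfar, hDR,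
    hwd, hwc, hwB, hw1, hwT, hθ, hL⟩ := hβ₁ β hβ
  obtain ⟨ω, hω0, hω1, hPJ⟩ := hP U D z₀ zT δ₀ R hUo hDo hDb hDc hDU hδ₀ hdisc hΩc hzT hzTfar hDR
  -- constants: contour bound `A`, anchor smallness `a_L`, improved rate `a'_L`
  set A : ℝ := max M 0 + 1 with hAdef
  have hA1 : 1 ≤ A := by
    have : 0 ≤ max M 0 := le_max_right _ _
    linarith
  have hMA : 1 + M ≤ A := by
    have : M ≤ max M 0 := le_max_left _ _
    linarith
  set a : ℕ → ℝ := fun L => (|C| + 1) * (L : ℝ) ^ 4 * Real.exp (-(c * (L : ℝ))) with hadef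
  set a' : ℕ → ℝ := fun L => (|C| + 1) * (L : ℝ) ^ 4 * Real.exp (-(c / 2 * (L : ℝ))) with ha'def
  have ha : Tendsto a atTop (𝓝 0) := tendsto_const_mul_pow_four_mul_exp_neg (|C| + 1) hc
  have ha' : Tendsto a' atTop (𝓝 0) := tendsto_const_mul_pow_four_mul_exp_neg (|C| + 1) (half_pos hc)
  have hb : Tendsto (fun L => a' L ^ ω * A ^ (1 - ω)) atTop (𝓝 0) := by
    have := (ha'.rpow_const (Or.inr hω0.le)).mul_const (A ^ (1 - ω))
    simpa [Real.zero_rpow hω0.ne'] using this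
  have hωc : 0 < ω * c / 4 := by positivity
  obtain ⟨L, ⟨⟨⟨hLε, hLa1⟩, hLθ⟩, hL1⟩, hLmax⟩ :=
    (((((hb.eventually_le_const hε).and (ha.eventually_le_const one_pos)).and
      (hθ.eventually_le_const hωc)).and (eventually_ge_atTop 1)).and
      (eventually_ge_atTop (max L₁ (max L₀A L₀Z)))).exists
  have hLL₁ : L₁ ≤ L := (le_max_left _ _).trans hLmax
  have hLA : L₀A ≤ L := ((le_max_left _ _).trans (le_max_right _ _)).trans hLmax
  have hLZ : L₀Z ≤ L := ((le_max_right _ _).trans (le_max_right _ _)).trans hLmax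
  refine ⟨L, hLL₁, ?_⟩
  obtain ⟨hfr, s, g, hsD, hbudget, hgd, hg0, hfact⟩ := hL L hLZ
  -- the two cold partition functions as functions of the channel parameter
  set Zt : ℂ → ℂ := fun z => weightFinTorusPartition (w z) L L L (L / 4) with hZt
  set Z2 : ℂ → ℂ := fun z => weightFinTorusPartition (w z) L L L (2 * (L / 4)) with hZ2
  have hZtd : DifferentiableOn ℂ Zt U := differentiableOn_weightFinTorusPartition hUo hwd hwc hwB L L L (L / 4)
  have hZ2d : DifferentiableOn ℂ Z2 U :=
    differentiableOn_weightFinTorusPartition hUo hwd hwc hwB L L L (2 * (L / 4))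
  have hratio : ∀ z, purityRatio (w z) L = Z2 z / Zt z ^ 2 := fun z => rfl
  -- `F := Z_t² − Z_{2t}`, `G := g² ∏_{s+s} = Z_t²` on `closure D`
  set F : ℂ → ℂ := fun z => Zt z ^ 2 - Z2 z with hF
  have hFd : DifferentiableOn ℂ F U := (hZtd.pow 2).sub hZ2d
  have hg2d : DifferentiableOn ℂ (fun z => g z ^ 2) U := hgd.pow 2
  have hg20 : ∀ z ∈ closure D, g z ^ 2 ≠ 0 := fun z hz => pow_ne_zero 2 (hg0 z hz)
  have hGsq : ∀ z ∈ closure D, g z ^ 2 * zeroProd (s + s) z = Zt z ^ 2 := fun z hz => by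
    rw [zeroProd_add, hZt]
    simp only
    rw [hfact z hz]
    ring
  -- the zeros miss the closed anchor disc (anchor: `Z_t ≠ 0` there) and the target
  have hanchor : ∀ z ∈ Metric.closedBall z₀ δ₀,
      Zt z ≠ 0 ∧ ‖1 - purityRatio (w z) L‖ ≤ C * (L : ℝ) ^ 4 * Real.exp (-(c * (L : ℝ))) := fun z hz =>
    hAnch G (w z) (hwc z (hDU (subset_closure (hdisc hz)))) (hw1 z hz) L hLA
  have hsP : ∀ ζ ∈ s + s, ζ ∈ D ∧ δ₀ < ‖ζ - z₀‖ ∧ ζ ≠ zT := by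
    intro ζ hζ
    have hζs : ζ ∈ s := by simpa [Multiset.mem_add] using hζ
    refine ⟨(hsD ζ hζs).1, ?_, (hsD ζ hζs).2⟩
    by_contra hle
    have hmem : ζ ∈ Metric.closedBall z₀ δ₀ := Metric.mem_closedBall.2 (by rw [dist_eq_norm]; exact not_lt.1 hle)
    have hzero : Zt ζ = 0 := by
      simp only [hZt]
      rw [hfact ζ (subset_closure (hsD ζ hζs).1), zeroProd_eq_zero_of_mem hζs, mul_zero]
    exact (hanchor ζ hmem).1 hzero
  -- contour bound: `‖F‖ ≤ (1+M)‖Z_t‖² ≤ A‖G‖` on `frontier D`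
  have hFA : ∀ z ∈ frontier D, ‖F z‖ ≤ A * ‖g z ^ 2 * zeroProd (s + s) z‖ := by
    intro z hz
    have hzcl : z ∈ closure D := frontier_subset_closure hz
    obtain ⟨hne, hMz⟩ := hfr z hz
    rw [hGsq z hzcl, norm_pow]
    have hZ2le : ‖Z2 z‖ ≤ M * ‖Zt z‖ ^ 2 := by
      have h := hMz
      rw [hratio, norm_div, norm_pow, div_le_iff₀ (by positivity)] at h
      exact h
    calc ‖F z‖ ≤ ‖Zt z ^ 2‖ + ‖Z2 z‖ := norm_sub_le _ _
      _ ≤ ‖Zt z‖ ^ 2 + M * ‖Zt z‖ ^ 2 := by rw [norm_pow]; linarith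
      _ = (1 + M) * ‖Zt z‖ ^ 2 := by ring
      _ ≤ A * ‖Zt z‖ ^ 2 := by gcongr
  -- anchor-circle bound: `‖F‖ = ‖Z_t‖²‖1 − h_L‖ ≤ a_L‖G‖`
  have hLpos : (0 : ℝ) < L := by exact_mod_cast hL1
  have ha_pos : 0 < a L := by
    simp only [hadef]
    positivity
  have hFa : ∀ z ∈ Metric.sphere z₀ δ₀, ‖F z‖ ≤ a L * ‖g z ^ 2 * zeroProd (s + s) z‖ := by
    intro z hz
    have hzb : z ∈ Metric.closedBall z₀ δ₀ := Metric.sphere_subset_closedBall hz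
    have hzcl : z ∈ closure D := subset_closure (hdisc hzb)
    obtain ⟨hne, hsmall⟩ := hanchor z hzb
    rw [hGsq z hzcl, norm_pow]
    have hFeq : F z = Zt z ^ 2 * (1 - purityRatio (w z) L) := by
      simp only [hF, hratio]
      field_simp
    rw [hFeq, norm_mul, norm_pow, mul_comm]
    refine mul_le_mul_of_nonneg_right (hsmall.trans ?_) (by positivity)
    simp only [hadef]
    gcongr
    exact (le_abs_self C).trans (le_add_of_nonneg_right zero_le_one)
  -- Poisson–Jensen at the target
  have key := hPJ F (fun z => g z ^ 2) (s + s) (a L) A hFd hg2d hg20 hsP ha_pos (hLa1.trans hA1) hFA hFa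
  have hzTcl : zT ∈ closure D := subset_closure hzT
  rw [hGsq zT hzTcl, greenBudget_add, norm_pow] at key
  -- identify the target values with the real Wilson partition functions
  have hZtT : Zt zT = ((wilsonFinTorusPartition r.ρ β L L L (L / 4) : ℝ) : ℂ) := by
    simp only [hZt, hwT]
    exact weightFinTorusPartition_wilsonWeightC_ofReal r.ρ β L L L (L / 4)
  have hZ2T : Z2 zT = ((wilsonFinTorusPartition r.ρ β L L L (2 * (L / 4)) : ℝ) : ℂ) := by
    simp only [hZ2, hwT]
    exact weightFinTorusPartition_wilsonWeightC_ofReal r.ρ β L L L (2 * (L / 4))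
  set Z1r : ℝ := wilsonFinTorusPartition r.ρ β L L L (L / 4) with hZ1r
  set Z2r : ℝ := wilsonFinTorusPartition r.ρ β L L L (2 * (L / 4)) with hZ2r
  have hZ1pos : 0 < Z1r := wilsonFinTorusPartition_pos r.continuous β L L L (L / 4)
  have hFzT : F zT = ((Z1r ^ 2 - Z2r : ℝ) : ℂ) := by
    simp only [hF, hZtT, hZ2T]
    push_cast
    ring
  have hnormZt : ‖Zt zT‖ = Z1r := by
    rw [hZtT, Complex.norm_real, Real.norm_eq_abs, abs_of_pos hZ1pos]
  have hdef : coldDefect r.ρ β L * Z1r ^ 2 = Z1r ^ 2 - Z2r := by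
    simp only [coldDefect, ← hZ1r, ← hZ2r]
    field_simp
  have hre : coldDefect r.ρ β L * Z1r ^ 2 ≤ ‖F zT‖ := by
    rw [hdef, hFzT, Complex.norm_real, Real.norm_eq_abs]
    exact le_abs_self _
  rw [hnormZt] at key
  -- `coldDefect · Z₁² ≤ a^ω A^{1−ω} e^{2 budget} Z₁²`, budget `≤ θ_L L`, and the rate absorbs `e^{2θ_L L}`
  have hexp : Real.exp (greenBudget s zT R + greenBudget s zT R) ≤ Real.exp (2 * θ L * (L : ℝ)) := by
    rw [Real.exp_le_exp]
    linarith
  have hbound : coldDefect r.ρ β L * Z1r ^ 2 ≤ (a' L ^ ω * A ^ (1 - ω)) * Z1r ^ 2 := by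
    refine hre.trans (key.trans ?_)
    have h1 : a L ^ ω * A ^ (1 - ω) * Real.exp (greenBudget s zT R + greenBudget s zT R) ≤
        a L ^ ω * A ^ (1 - ω) * Real.exp (2 * θ L * (L : ℝ)) := by gcongr
    have h2 : a L ^ ω * Real.exp (2 * θ L * (L : ℝ)) ≤ a' L ^ ω := by
      simp only [hadef, ha'def]
      exact rpow_mul_exp_le_of_sublinear (by positivity) L hLθ
    have h3 : a L ^ ω * A ^ (1 - ω) * Real.exp (2 * θ L * (L : ℝ)) ≤ a' L ^ ω * A ^ (1 - ω) := by
      have hA' : 0 ≤ A ^ (1 - ω) := by positivity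
      calc a L ^ ω * A ^ (1 - ω) * Real.exp (2 * θ L * (L : ℝ))
          = (a L ^ ω * Real.exp (2 * θ L * (L : ℝ))) * A ^ (1 - ω) := by ring
        _ ≤ a' L ^ ω * A ^ (1 - ω) := by gcongr
    exact mul_le_mul_of_nonneg_right (h1.trans h3) (by positivity)
  have : coldDefect r.ρ β L ≤ a' L ^ ω * A ^ (1 - ω) := le_of_mul_le_mul_right hbound (by positivity)
  exact this.trans hLε

/-- **SEAM, UNCONDITIONAL IN P** (P is the tree theorem `PurityChannelClassical.poissonJensen_holds`, p635605):
`SparseChannel → ComplexAnchor → ColdExitSC` — line jensen-purity-channel reduces to its LOAD and the shared located supplier. -/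
theorem coldExitSC_of_sparse (hJ : SparseChannel) (hA : ComplexAnchor) : ColdExitSC :=
  coldExitSC_of_sparse_poissonJensen hJ hA poissonJensen_holds


/-! ## §2 (appended) The two lines' BILLS by name: `LOAD ∧ ComplexAnchor ∧ X ∧ N ⇒ BalabanLadder.IR` -/

section Bills

open Summit.QuantumFields.YangMills.Cruxes.IR.ColdPressurePincer (AFToColdPressure IRnsc)
open Summit.QuantumFields.YangMills.Cruxes.IR.ColdPurityBridge (IR_of_bridge)
open Summit.QuantumFields.YangMills.Cruxes.IR.AspectBootstrap (R_holds)

/-- **Bill of line `harmonic-purity-channel`, kernel-checked composition:** `PurityChannel ∧ ComplexAnchor ∧ AFToColdPressure ∧ IRnsc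
⇒ BalabanLadder.IR` — the seam `coldExitSC_of_channel` (T discharged), the PROVED scale transfer `R_holds` and the PROVED bridge
`IR_of_bridge`.  (The loads and the residual are hypotheses; nothing is claimed about them.) -/
theorem IR_of_purityChannel (hZ : PurityChannel) (hA : ComplexAnchor) (hX : AFToColdPressure) (hN : IRnsc) :
    Summit.QuantumFields.YangMills.Theses.BalabanLadder.IR :=
  IR_of_bridge R_holds (coldExitSC_of_channel hZ hA) hX hN

/-- **Bill of line `jensen-purity-channel`, kernel-checked composition:** `SparseChannel ∧ ComplexAnchor ∧ AFToColdPressure ∧ IRnsc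
⇒ BalabanLadder.IR` (seam `coldExitSC_of_sparse`, P discharged; `R_holds`; `IR_of_bridge`). -/
theorem IR_of_sparseChannel (hJ : SparseChannel) (hA : ComplexAnchor) (hX : AFToColdPressure) (hN : IRnsc) :
    Summit.QuantumFields.YangMills.Theses.BalabanLadder.IR :=
  IR_of_bridge R_holds (coldExitSC_of_sparse hJ hA) hX hN

end Bills

end Summit.QuantumFields.YangMills.Cruxes.IR.PurityChannelFamily

end
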